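import Summits.ValiantsHypothesis.ValiantsHypothesis.Theses.LiftNullstellensatz
import Summits.ValiantsHypothesis.ValiantsHypothesis.Theorems.LiftNullstellensatzLiftWidthGeThree
import Literature.Computability.AlgebraicComplexity.WordLiftWidth

/-!
# Crux `LiftAvoidanceQP` (stmt-ValiantsHypothesis-5919) — typed decomposition candidates and
# their seams (strategist workfile; companion of `STRATEGY-CENSUS.md` §3)

Every candidate typed split `X₁ ∧ … ∧ X_k → X` of the deciding crux
`X = LiftNullstellensatz.LiftAvoidanceQP` that the census discusses is stated here as Lean
signatures over existing declarations, together with the kernel-checked facts that DISQUALIFY it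
under the BC2-redirect certificate — either the assembly is a trivial seam ((b) fails), or a piece
is implied by `X` vacuously / is at least `X` ((c) fails in letter or in spirit):

* §1 `normalFormBelow_of_liftAvoidanceQP` — for EVERY predicate `T` on lifts and EVERY threshold
  `L`, the thresholded normal-form piece "a lift of TT-rank `≤ 2^((log₂ n + c)^c)` can be replaced
  by a `T`-lift of TT-rank `< L n`" is implied by `X` VACUOUSLY; with the matching restricted lower
  bound `RestrictedBound T L` the pair assembles to `X` (`liftAvoidanceQP_of_normalForm`), so
  whenever the restricted bound is a theorem (equivariant lifts: Landsberg–Ressayre / Dawar–Wilsenach;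
  bi-multilinear lifts: covering) the normal-form piece is `X` modulo a theorem — a costume.
* §2 `restricted_le_uniform` — the UNIFORM normal form (no threshold) composes with a restricted
  bound `L` to `L n ≤ F (wordTTRank Ψ) n` for EVERY lift: with `L n = C(n, ⌊n/2⌋)` and `F`
  quasi-polynomial this is a stretched-exponential lower bound, i.e. the piece overshoots `X`.
* §3 `liftAvoidancePoly_of_liftAvoidanceQP`, `liftAvoidanceQP_of_poly_boost`, `boost_of_liftAvoidanceQP`
  — the polynomial-scale avoidance `X_poly` (= `VNP ⊄ VBP_hom`, a consequence of the summit) is a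
  consequence of `X`; the only typed "boost" making `X_poly ∧ Boost → X` is the implication itself,
  a ONE-LINE seam, and `Boost` is again implied by `X`.
* §4 `liftAvoidanceQP_of_productRankQP` — the balanced/any-cut PRODUCT-RANK bound
  `ProductRankQP` ("per_n is not a sum of `≤ 2^((log₂ n + c)^c)` products `g·h` of word-homogeneous
  forms of complementary lengths") implies `X` by rank factorisation of one flattening (Kumar's
  device, as in the landed `LiftWidthGeThree`): it is a STRENGTHENING of `X` (decoupled cuts), not a
  piece of it.
* §5 `multilinearLiftAvoidanceQP_of_liftAvoidanceQP` — restricted-class avoidance statements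
  (injective-support = semantically multilinear lifts; bi-multilinear = torus-fixed lifts) are
  consequences of `X`; their complements re-assemble to `X` only through excluded middle
  (`liftAvoidanceQP_of_cases`, the trivial case seam) or through a normal form (§1–§2).

Nothing here is proposed to the tree; `sorry`-free; axioms standard.
-/

-- `Summit.ValiantsHypothesis.ValiantsHypothesis.…` is the tree's mandated single-conjunct layout.
set_option linter.dupNamespace false

noncomputable section

namespace Summit.ValiantsHypothesis.ValiantsHypothesis.Cruxes.LiftAvoidanceQP.Splits

open MvPolynomial Matrix
open Literature.Computability.AlgebraicComplexity
open Summit.ValiantsHypothesis.ValiantsHypothesis.Theses.LiftNullstellensatz (LiftAvoidanceQP)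
open Summit.ValiantsHypothesis.LiftNullstellensatz (exists_mul_eq_of_rank_eq sum_word_eq_sum_append)

/-- The quasi-polynomial scale `2^((log₂ n + c)^c)` of the route. -/
abbrev qp (c n : ℕ) : ℕ := 2 ^ ((Nat.log 2 n + c) ^ c)

/-- `X` in the Literature vocabulary (`IsWordLift`, `wordFlattening`): definitionally the filed crux. -/
theorem liftAvoidanceQP_iff :
    LiftAvoidanceQP ↔ ∀ c : ℕ, ∃ n₀ : ℕ, ∀ n ≥ n₀, ∀ Ψ : (Fin n → Fin n × Fin n) → ℂ,
      IsWordLift Ψ (perPoly (Fin n) ℂ) →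
        ∃ (k l : ℕ) (h : k + l = n), qp c n < (wordFlattening Ψ k l h).rank :=
  Iff.rfl

/-- `X` says exactly: eventually every lift has TT-rank `> 2^((log₂ n + c)^c)`. -/
theorem liftAvoidanceQP_iff_wordTTRank :
    LiftAvoidanceQP ↔ ∀ c : ℕ, ∃ n₀ : ℕ, ∀ n ≥ n₀, ∀ Ψ : (Fin n → Fin n × Fin n) → ℂ,
      IsWordLift Ψ (perPoly (Fin n) ℂ) → qp c n < wordTTRank Ψ := by
  rw [liftAvoidanceQP_iff]
  refine forall_congr' fun c => exists_congr fun n₀ => forall_congr' fun n =>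
    forall_congr' fun _ => forall_congr' fun Ψ => forall_congr' fun _ => ⟨?_, exists_cut_of_lt_wordTTRank⟩
  rintro ⟨k, l, h, hlt⟩
  exact hlt.trans_le (rank_wordFlattening_le_wordTTRank Ψ k l h)

/-! ## §1 Thresholded normal forms are implied by `X` vacuously -/

section NormalForm

variable (T : ∀ n : ℕ, ((Fin n → Fin n × Fin n) → ℂ) → Prop) (L : ℕ → ℕ)

/-- Candidate piece (restoration / normal form BELOW A THRESHOLD): eventually, every lift of
`per_n` of TT-rank `≤ 2^((log₂ n + c)^c)` can be replaced by a lift with property `T`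
(equivariant, bi-multilinear, injective support, …) of TT-rank `< L n`. -/
def NormalFormBelow : Prop :=
  ∀ c : ℕ, ∃ n₀ : ℕ, ∀ n ≥ n₀, ∀ Ψ : (Fin n → Fin n × Fin n) → ℂ,
    IsWordLift Ψ (perPoly (Fin n) ℂ) → wordTTRank Ψ ≤ qp c n →
      ∃ Ψ' : (Fin n → Fin n × Fin n) → ℂ,
        IsWordLift Ψ' (perPoly (Fin n) ℂ) ∧ T n Ψ' ∧ wordTTRank Ψ' < L n

/-- Candidate piece (restricted-model lower bound): eventually every `T`-lift of `per_n` has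
TT-rank `≥ L n`. A THEOREM for `T` = bi-multilinear with `L n = C(n, ⌊n/2⌋)` (covering argument,
census §1b) and — via `dc ≤ 1 + Σ_k r_k` — for `T` = left-monomial-equivariant with
`L n = (2^n - 1)/n` (Landsberg–Ressayre 2017 Thm 2.8, proved in tree for determinantal expressions). -/
def RestrictedBound : Prop :=
  ∃ n₁ : ℕ, ∀ n ≥ n₁, ∀ Ψ' : (Fin n → Fin n × Fin n) → ℂ,
    IsWordLift Ψ' (perPoly (Fin n) ℂ) → T n Ψ' → L n ≤ wordTTRank Ψ'

variable {T L}

/-- The assembly of the pair is genuine (not a one-liner) … -/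
theorem liftAvoidanceQP_of_normalForm (hN : NormalFormBelow T L) (hR : RestrictedBound T L) :
    LiftAvoidanceQP := by
  rw [liftAvoidanceQP_iff_wordTTRank]
  intro c
  obtain ⟨n₀, hn₀⟩ := hN c
  obtain ⟨n₁, hn₁⟩ := hR
  refine ⟨max n₀ n₁, fun n hn Ψ hΨ => ?_⟩
  by_contra hsmall
  obtain ⟨Ψ', hΨ', hT, hlt⟩ := hn₀ n (le_of_max_le_left hn) Ψ hΨ (not_lt.mp hsmall)
  exact absurd (hn₁ n (le_of_max_le_right hn) Ψ' hΨ' hT) (not_le.mpr hlt)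

/-- … but the normal-form piece is implied by `X` VACUOUSLY, for every `T` and `L`: it is `X` or
nothing (sandwich `X → NormalFormBelow T L → (RestrictedBound T L → X)`). -/
theorem normalFormBelow_of_liftAvoidanceQP (hX : LiftAvoidanceQP) : NormalFormBelow T L := by
  rw [liftAvoidanceQP_iff_wordTTRank] at hX
  intro c
  obtain ⟨n₀, hn₀⟩ := hX c
  refine ⟨n₀, fun n hn Ψ hΨ hle => ?_⟩
  exact absurd hle (not_le.mpr (hn₀ n hn Ψ hΨ))

end NormalForm

/-! ## §2 Uniform normal forms overshoot -/

section Uniform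

variable (T : ∀ n : ℕ, ((Fin n → Fin n × Fin n) → ℂ) → Prop) (F : ℕ → ℕ → ℕ) (L : ℕ → ℕ)

/-- Candidate piece (UNIFORM restoration / normal form): every lift of `per_n` of TT-rank `w` can
be replaced by a `T`-lift of TT-rank `≤ F w n` (`F` quasi-polynomial, say). Not implied by `X`. -/
def NormalFormUniform : Prop :=
  ∀ (n : ℕ) (Ψ : (Fin n → Fin n × Fin n) → ℂ), IsWordLift Ψ (perPoly (Fin n) ℂ) →
    ∃ Ψ' : (Fin n → Fin n × Fin n) → ℂ,
      IsWordLift Ψ' (perPoly (Fin n) ℂ) ∧ T n Ψ' ∧ wordTTRank Ψ' ≤ F (wordTTRank Ψ) n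

variable {T F L}

/-- With a restricted bound it yields `L n ≤ F (wordTTRank Ψ) n` for EVERY lift — for
`L n = C(n,⌊n/2⌋)` and `F` quasi-polynomial an `exp(n^{Ω(1)})` lower bound on every lift, far
beyond `X`: the uniform piece is (modulo the restricted theorem) a stretched-exponential hardness
claim for the permanent. -/
theorem restricted_le_uniform (hU : NormalFormUniform T F) (hR : RestrictedBound T L) :
    ∃ n₁ : ℕ, ∀ n ≥ n₁, ∀ Ψ : (Fin n → Fin n × Fin n) → ℂ,
      IsWordLift Ψ (perPoly (Fin n) ℂ) → L n ≤ F (wordTTRank Ψ) n := by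
  obtain ⟨n₁, hn₁⟩ := hR
  refine ⟨n₁, fun n hn Ψ hΨ => ?_⟩
  obtain ⟨Ψ', hΨ', hT, hle⟩ := hU n Ψ hΨ
  exact (hn₁ n hn Ψ' hΨ' hT).trans hle

end Uniform

/-! ## §3 Polynomial scale plus "boost": a consequence of the summit and a one-line seam -/

/-- Arithmetic: `n^c ≤ 2^((log₂ n + c)^c)` for all `n, c`. -/
theorem pow_le_qp (n c : ℕ) : n ^ c ≤ qp c n := by
  have hn : n < 2 ^ (Nat.log 2 n + 1) := Nat.lt_pow_succ_log_self one_lt_two n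
  have h1 : n ^ c ≤ 2 ^ (c * (Nat.log 2 n + 1)) := by
    rw [pow_mul']
    exact Nat.pow_le_pow_left hn.le c
  refine h1.trans (Nat.pow_le_pow_right two_pos ?_)
  rcases Nat.lt_or_ge c 2 with hc | hc
  · interval_cases c <;> simp
  · calc c * (Nat.log 2 n + 1) ≤ (Nat.log 2 n + c) ^ 2 := by nlinarith
      _ ≤ (Nat.log 2 n + c) ^ c := Nat.pow_le_pow_right (by omega) hc

/-- Candidate piece `X_poly` (polynomial-scale lift avoidance = "no polynomial-width homogeneous
ABP for the permanent", i.e. `VNP ⊄ VBP` in lift form — a CONSEQUENCE of the summit `VP ≠ VNP`, and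
the natural conclusion of the route's rank-2 crux `PolyDegreeCertificates` by soundness). -/
def LiftAvoidancePoly : Prop :=
  ∀ c : ℕ, ∃ n₀ : ℕ, ∀ n ≥ n₀, ∀ Ψ : (Fin n → Fin n × Fin n) → ℂ,
    IsWordLift Ψ (perPoly (Fin n) ℂ) →
      ∃ (k l : ℕ) (h : k + l = n), n ^ c < (wordFlattening Ψ k l h).rank

/-- `X_poly` is a consequence of `X`. -/
theorem liftAvoidancePoly_of_liftAvoidanceQP (hX : LiftAvoidanceQP) : LiftAvoidancePoly := by
  intro c
  obtain ⟨n₀, hn₀⟩ := hX c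
  refine ⟨n₀, fun n hn Ψ hΨ => ?_⟩
  obtain ⟨k, l, h, hlt⟩ := hn₀ n hn Ψ hΨ
  exact ⟨k, l, h, (pow_le_qp n c).trans_lt hlt⟩

/-- Candidate piece "boost" (collapse-type: polynomial-scale hardness ⇒ quasi-polynomial-scale
hardness of the permanent's lift width). As a bare implication it is typed, open, and … -/
def Boost : Prop := LiftAvoidancePoly → LiftAvoidanceQP

/-- … the assembly `X_poly ∧ Boost → X` is the ONE-LINE seam the certificate rejects ((b)); -/
theorem liftAvoidanceQP_of_poly_boost (h₁ : LiftAvoidancePoly) (h₂ : Boost) : LiftAvoidanceQP :=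
  h₂ h₁

/-- … and `Boost` is itself implied by `X` (so, given the consequence `X_poly`, `Boost ⟺ X`). No
MECHANISM for a boost exists in this model: TT-rank is max-stable under products
(`TT-rank (Ψ_f ⊗ Ψ_g) = max`), so there is no tensor-power self-amplification (census §2d). -/
theorem boost_of_liftAvoidanceQP (hX : LiftAvoidanceQP) : Boost := fun _ => hX

/-! ## §4 Product rank at one cut: a strengthening, kernel-certified to imply `X` -/

/-- `per_n` is a sum of at most `r` products `g_i · h_i` with `g_i` (resp. `h_i`) a linear
combination of word monomials of length `k` (resp. `l`) — "(k,l)-product rank `≤ r`", the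
DECOUPLED shadow of a rank-`≤ r` cut of a lift. -/
def HasProductDecomp (n k l r : ℕ) : Prop :=
  ∃ r₀ ≤ r, ∃ (g h : Fin r₀ → MvPolynomial (Fin n × Fin n) ℂ),
    (∀ i, g i ∈ Submodule.span ℂ
      (Set.range fun u : Fin k → Fin n × Fin n => ∏ s, (X (u s) : MvPolynomial (Fin n × Fin n) ℂ))) ∧
    (∀ i, h i ∈ Submodule.span ℂ
      (Set.range fun v : Fin l → Fin n × Fin n => ∏ s, (X (v s) : MvPolynomial (Fin n × Fin n) ℂ))) ∧
    perPoly (Fin n) ℂ = ∑ i, g i * h i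

/-- Candidate piece `PR` (lens `strengthen`): eventually, at SOME cut `k + l = n`, the permanent has
(k,l)-product rank `> 2^((log₂ n + c)^c)`. Open; believed (Laplace/Grenet give `≤ C(n,k)`, nothing
below); every known engine stops at linear `r` (singular-locus / Krull height, as in rung
`LiftWidthGeThree`). -/
def ProductRankQP : Prop :=
  ∀ c : ℕ, ∃ n₀ : ℕ, ∀ n ≥ n₀, ∃ k l : ℕ, k + l = n ∧ ¬ HasProductDecomp n k l (qp c n)

/-- **Rank factorisation of one cut gives a product decomposition** (Kumar's device; the first half
of the landed `three_le_rank_of_forall_apply_eq`): a lift of `per_{k+l}` whose `(k,l)`-flattening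
has rank `≤ r` writes `per_{k+l}` as `≤ r` products of word-homogeneous forms of lengths `k`, `l`. -/
theorem hasProductDecomp_of_rank_le {k l r : ℕ}
    (Ψ : (Fin (k + l) → Fin (k + l) × Fin (k + l)) → ℂ)
    (hΨ : IsWordLift Ψ (perPoly (Fin (k + l)) ℂ))
    (hr : (wordFlattening Ψ k l rfl).rank ≤ r) : HasProductDecomp (k + l) k l r := by
  classical
  obtain ⟨r₀, hr₀⟩ : ∃ r₀, (wordFlattening Ψ k l rfl).rank = r₀ := ⟨_, rfl⟩
  obtain ⟨A, B, hAB⟩ := exists_mul_eq_of_rank_eq _ hr₀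
  refine ⟨r₀, hr₀ ▸ hr, fun i => ∑ u : Fin k → Fin (k + l) × Fin (k + l), A u i • ∏ s, X (u s),
    fun i => ∑ v : Fin l → Fin (k + l) × Fin (k + l), B i v • ∏ s, X (v s), ?_, ?_, ?_⟩
  · intro i
    exact Submodule.sum_mem _ fun u _ =>
      Submodule.smul_mem _ _ (Submodule.subset_span ⟨u, rfl⟩)
  · intro i
    exact Submodule.sum_mem _ fun v _ =>
      Submodule.smul_mem _ _ (Submodule.subset_span ⟨v, rfl⟩)
  · -- `per = Σ_i g_i h_i`
    have hΨ' : (∑ w : Fin (k + l) → Fin (k + l) × Fin (k + l),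
        Ψ w • ∏ t, (X (w t) : MvPolynomial (Fin (k + l) × Fin (k + l)) ℂ)) =
          perPoly (Fin (k + l)) ℂ := hΨ
    rw [← hΨ', sum_word_eq_sum_append]
    have hentry : ∀ (u : Fin k → Fin (k + l) × Fin (k + l))
        (v : Fin l → Fin (k + l) × Fin (k + l)), Ψ (Fin.append u v) = ∑ i, A u i * B i v := by
      intro u v
      have := congrArg (fun M => M u v) hAB
      simpa [Matrix.mul_apply, wordFlattening] using this.symm
    simp only [hentry, Finset.sum_smul, Finset.sum_mul_sum]
    symm
    rw [Finset.sum_comm]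
    refine Finset.sum_congr rfl fun u _ => ?_
    rw [Finset.sum_comm]
    refine Finset.sum_congr rfl fun v _ => Finset.sum_congr rfl fun i _ => ?_
    rw [smul_eq_C_mul, smul_eq_C_mul, smul_eq_C_mul, map_mul, mul_mul_mul_comm]

/-- **`PR → X`** (kernel-certified): the product-rank piece is AT LEAST the crux — a strengthening
(lens `strengthen`), not a decomposition piece ((c) in spirit: `PR ≥ X ≥ S`). The converse is the
COUPLING phenomenon the route's thesis bets on and is not claimed. -/
theorem liftAvoidanceQP_of_productRankQP (hPR : ProductRankQP) : LiftAvoidanceQP := by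
  intro c
  obtain ⟨n₀, hn₀⟩ := hPR c
  refine ⟨n₀, fun n hn Ψ hΨ => ?_⟩
  obtain ⟨k, l, hkl, hno⟩ := hn₀ n hn
  by_contra hsmall
  push Not at hsmall
  subst hkl
  exact hno (hasProductDecomp_of_rank_le Ψ hΨ (hsmall k l rfl))

/-! ## §5 Restricted classes are consequences; complements re-assemble only by excluded middle -/

/-- Injective-support ("semantically multilinear") lifts: no variable occurs twice in a word of the
support. -/
def IsInjectiveSupport {n : ℕ} (Ψ : (Fin n → Fin n × Fin n) → ℂ) : Prop :=
  ∀ w, Ψ w ≠ 0 → Function.Injective w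

/-- Bi-multilinear (torus-fixed) lifts: every word of the support uses each row once and each
column once (Grenet's lift is one). -/
def IsBiMultilinear {n : ℕ} (Ψ : (Fin n → Fin n × Fin n) → ℂ) : Prop :=
  ∀ w, Ψ w ≠ 0 → Function.Injective (fun t => (w t).1) ∧ Function.Injective (fun t => (w t).2)

/-- Bi-multilinear lifts have injective support. -/
theorem IsBiMultilinear.isInjectiveSupport {n : ℕ} {Ψ : (Fin n → Fin n × Fin n) → ℂ}
    (h : IsBiMultilinear Ψ) : IsInjectiveSupport Ψ :=
  fun w hw _ _ htt' => (h w hw).1 (congrArg Prod.fst htt')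

/-- Candidate piece `P_ml` — MULTILINEAR LIFT AVOIDANCE: eventually every injective-support lift of
`per_n` has a cut of rank `> 2^((log₂ n + c)^c)` (no quasi-polynomial-width semantically-multilinear
homogeneous ABP for the permanent). A consequence of `X`; open (best bounds in multilinear ABP
models are quadratic); plausibly TRUE FOR `det_n` AS WELL — the one restricted class met in this
census where a proof need not separate `per` from `det`. Recommended as a rung, not as a piece. -/
def MultilinearLiftAvoidanceQP : Prop :=
  ∀ c : ℕ, ∃ n₀ : ℕ, ∀ n ≥ n₀, ∀ Ψ : (Fin n → Fin n × Fin n) → ℂ,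
    IsWordLift Ψ (perPoly (Fin n) ℂ) → IsInjectiveSupport Ψ →
      ∃ (k l : ℕ) (h : k + l = n), qp c n < (wordFlattening Ψ k l h).rank

/-- `X → P_ml` (restriction to a subclass). -/
theorem multilinearLiftAvoidanceQP_of_liftAvoidanceQP (hX : LiftAvoidanceQP) :
    MultilinearLiftAvoidanceQP := by
  intro c
  obtain ⟨n₀, hn₀⟩ := hX c
  exact ⟨n₀, fun n hn Ψ hΨ _ => hn₀ n hn Ψ hΨ⟩

/-- Candidate piece (the provable calibration rung, census §1b): every bi-multilinear lift of
`per_n` has `(k, n-k)`-flattening rank `≥ C(n,k)` at EVERY cut (torus-weight block decomposition +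
covering: each nonzero block `(A,B)` covers `k!(n-k)!` of the `n!` permutation monomials). The
same statement and proof hold verbatim for `det_n`; stated, not proved here. -/
def BiMultilinearBound : Prop :=
  ∀ (n : ℕ) (Ψ : (Fin n → Fin n × Fin n) → ℂ), IsWordLift Ψ (perPoly (Fin n) ℂ) →
    IsBiMultilinear Ψ → ∀ (k l : ℕ) (h : k + l = n), Nat.choose n k ≤ (wordFlattening Ψ k l h).rank

/-- **The case seam**: two restricted avoidance statements over complementary classes `P`, `¬P`
re-assemble to `X` by excluded middle only — the trivial seam ((b)); each half is a consequence of
`X`, and the half over the class with no independent mechanism is inert (census §3e). -/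
theorem liftAvoidanceQP_of_cases (P : ∀ n : ℕ, ((Fin n → Fin n × Fin n) → ℂ) → Prop)
    (h₁ : ∀ c : ℕ, ∃ n₀ : ℕ, ∀ n ≥ n₀, ∀ Ψ : (Fin n → Fin n × Fin n) → ℂ,
      IsWordLift Ψ (perPoly (Fin n) ℂ) → P n Ψ →
        ∃ (k l : ℕ) (h : k + l = n), qp c n < (wordFlattening Ψ k l h).rank)
    (h₂ : ∀ c : ℕ, ∃ n₀ : ℕ, ∀ n ≥ n₀, ∀ Ψ : (Fin n → Fin n × Fin n) → ℂ,
      IsWordLift Ψ (perPoly (Fin n) ℂ) → ¬ P n Ψ →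
        ∃ (k l : ℕ) (h : k + l = n), qp c n < (wordFlattening Ψ k l h).rank) :
    LiftAvoidanceQP := by
  intro c
  obtain ⟨n₁, hn₁⟩ := h₁ c
  obtain ⟨n₂, hn₂⟩ := h₂ c
  refine ⟨max n₁ n₂, fun n hn Ψ hΨ => ?_⟩
  by_cases hP : P n Ψ
  · exact hn₁ n (le_of_max_le_left hn) Ψ hΨ hP
  · exact hn₂ n (le_of_max_le_right hn) Ψ hΨ hP

end Summit.ValiantsHypothesis.ValiantsHypothesis.Cruxes.LiftAvoidanceQP.Splits

end
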